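import Mathlib.Computability.Language
import Mathlib.Probability.ProbabilityMassFunction.Basic
import Literature.Computability.Cryptography.QubitRegister
import Literature.Computability.Cryptography.QuantumCircuit
import Literature.Computability.Complexity.Classes
import Literature.Computability.Complexity.Promise
import Literature.Computability.Complexity.Oracle
import HarnessLib

-- provenance: harness21/H21/H21/Prelude/CryptoQuantFine/ClassBQP.lean @ 7b3359d (interim HEAD d8f2665); M5 mechanical rewrite
/-!
# The class BQP and its relatives (trunk CryptoQuantFine, outline Q3)

This prelude file realises the notions `class_BQP` and (the class level of)
`oracle_quantum_circuit` of the CryptoQuantFine outline, on top of Q2 (`QuantumCircuit`) and the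
complexity core G01 (`P`, `co`, `PromiseProblem`):

* `BQPWith G ε` — languages decided by a poly-time uniform, oracle-free family of quantum
  circuits over the gate set `G` with two-sided error `ε`; `BQPOver G := BQPWith G (1/3)`,
  `BQP := BQPOver cliffordT`, `EQP := BQPWith cliffordT 0`;
* `BQPRel A` — `BQP` relative to the oracle language `A` (oracle gates allowed, semantics
  `acceptProbOn A`), `BQPRelClass C = BQP^C`;
* `PromiseBQP` — the promise-problem version (replaces the provisional `Literature.PQC.PromiseBQP` of
  G10, same shape; outline R12);
* search problems: `IsQSolvableRel A R`, `IsQSolvable R` (a uniform quantum circuit family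
  outputs, with probability `≥ 2/3`, a string in `R x`), and the function class `FBQP`;
* API: `BQPRel_zero`, `P_subset_BQP`, `BQPWith_mono`, `BQP_eq_BQPWith`, `co_BQP`,
  `ofLanguage_mem_PromiseBQP_iff`, `BQP_subset_BQPRel`.

Throughout, the empty oracle is the empty language `0 : Language Bool` (Mathlib's `Language` is a
semiring with `0 = ∅`).

## Sources

* E. Bernstein, U. Vazirani, *Quantum complexity theory*, SIAM J. Comput. 26 (1997), Def. 8
  (BQP, EQP), §8 (oracle quantum machines, `BQP^A`).
* A. C.-C. Yao, *Quantum circuit complexity*, FOCS 1993 (BQP via uniform circuit families).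
* L. Adleman, J. DeMarrais, M.-D. Huang, *Quantum computability*, SIAM J. Comput. 26 (1997)
  (gate-set/amplitude sensitivity of EQP; `BQP` robust).
* J. Watrous, *Quantum computational complexity*, Encyclopedia of Complexity and Systems Science
  (2009), §III.1–III.2 (BQP, PromiseBQP, FBQP, error reduction).
* S. Aaronson, *BQP and the polynomial hierarchy*, STOC 2010, §1 (relativised BQP, FBQP).

## Mathlib

Used: `Language` (with `0 = ∅`), `Set`, `List.IsPrefix` (`<+:`), `PMF` (through Q2's
`kernelProb`). Mathlib has no complexity classes, quantum or classical (searched: `BQP`, `EQP`,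
`PromiseBQP`, `quantum`, `DTIME`). From H21: `QCircuitFamily`, `IsOracleFree`, `IsUniform`,
`acceptProbOn`, `kernelProb`, `cliffordT` (Q1/Q2); `P`, `co` (G01 Classes); `PromiseProblem`,
`PromiseProblem.ofLanguage` (G01 Promise).

## Design choices

* Class names are the customary acronyms (`BQP`, `EQP`, `FBQP`, `PromiseBQP`), inside
  `namespace Literature.CryptoQuantFine` (same documented deviation from lowerCamelCase as G01's `P`,
  `NP`, outline D7).
* The gate set is a parameter of `BQPWith`/`BQPOver`; `BQP` fixes Clifford+T (`cliffordT`,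
  universal), which is the robust choice by the Solovay–Kitaev theorem; `EQP` (zero error) is
  gate-set sensitive and is fixed to Clifford+T as well, documented at the definition.
* Uniformity is G01's poly-time uniformity `QCircuitFamily.IsUniform` (which implies polynomial
  size, `IsUniform.isPolySize`); no advice.
* Relativised classes take the oracle as a `Language Bool` (the oracle gate of Q2 is the XOR
  query of a language), not as G01's function oracle `Oracle`; `BQPRelClass C = ⋃ A ∈ C, BQPRel A`
  parallels G01's `PRelClass`.
* Search problems: the classical output of a family is the measurement of *all* wires
  (`QCircuitFamily.kernel`), so a relation `R x` must be closed under the relevant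
  post-processing; for `FBQP` we ask that the function value be a *prefix* of the measured
  string (`f x <+: y`), i.e. the circuit writes `f x` on its first `|f x|` wires.
-/

open Computability Literature.Computability.Complexity Literature.Computability.Complexity.Classes

namespace Literature.Computability.Cryptography

/-! ### BQP with a gate set and an error bound -/

/-- `BQPWith G ε`: the languages `L ⊆ {0,1}*` decided with two-sided error `ε` by a poly-time
uniform, oracle-free family `F` of quantum circuits over the gate set `G`: on every input `x`,
the acceptance probability (measure wire `0` after running `F.circ |x|` on `|x⟩|0…0⟩`) is
`≥ 1 - ε` if `x ∈ L` and `≤ ε` if `x ∉ L`. [Bernstein–Vazirani 1997, Def. 8; Yao 1993;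
Watrous 2009, §III.1] [cite: BernsteinVazirani1997, Def. 8] -/
def BQPWith (G : QGateSet) [Encodable G.Op] (ε : ℝ) : Set (Language Bool) :=
  {L | ∃ F : QCircuitFamily G, F.IsOracleFree ∧ F.IsUniform ∧
    ∀ x, (x ∈ L → 1 - ε ≤ F.acceptProbOn 0 x) ∧ (x ∉ L → F.acceptProbOn 0 x ≤ ε)}

/-- `BQPOver G := BQPWith G (1/3)`: bounded-error quantum polynomial time over the gate set `G`
(error `1/3`). [Bernstein–Vazirani 1997, Def. 8; Watrous 2009, §III.1] [cite: BernsteinVazirani1997, Def. 8] -/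
def BQPOver (G : QGateSet) [Encodable G.Op] : Set (Language Bool) :=
  BQPWith G (1 / 3)

/-- The `Encodable` structure on the gate alphabet of Clifford+T (transported from
`CliffordTOp`, of which `cliffordT.Op` is definitionally equal; needed because `cliffordT` is a
definition and instance search does not unfold it). [folklore] -/
noncomputable instance instEncodableOpCliffordT : Encodable cliffordT.Op := inferInstanceAs (Encodable CliffordTOp)

/-- **BQP**: bounded-error quantum polynomial time, `BQPOver cliffordT` — languages decided with
error `≤ 1/3` by poly-time uniform families of quantum circuits over the universal gate set
Clifford+T. By the Solovay–Kitaev theorem the class does not depend on the choice of a finite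
universal gate set with algebraic entries. [Bernstein–Vazirani 1997, Def. 8; Yao 1993;
Watrous 2009, §III.1] [cite: BernsteinVazirani1997, Def. 8] -/
def BQP : Set (Language Bool) :=
  BQPOver cliffordT

/-- **EQP**: exact quantum polynomial time, `BQPWith cliffordT 0` — languages decided with zero
error by poly-time uniform families of Clifford+T circuits. *Warning:* unlike `BQP`, this class
is sensitive to the gate set (Adleman–DeMarrais–Huang 1997); we fix Clifford+T.
[Bernstein–Vazirani 1997, Def. 8; Adleman–DeMarrais–Huang 1997] [cite: BernsteinVazirani1997, Def. 8] -/
def EQP : Set (Language Bool) :=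
  BQPWith cliffordT 0

/-! ### Relativised BQP -/

/-- `BQPRel A = BQP^A`: languages decided with error `≤ 1/3` by a poly-time uniform family of
Clifford+T circuits *with oracle gates*, the oracle gates being interpreted as XOR queries to the
language `A` (`acceptProbOn A`). [Bernstein–Vazirani 1997, §8; Aaronson 2010, §1] [cite: BernsteinVazirani1997, §8] -/
def BQPRel (A : Language Bool) : Set (Language Bool) :=
  {L | ∃ F : QCircuitFamily cliffordT, F.IsUniform ∧
    ∀ x, (x ∈ L → 2 / 3 ≤ F.acceptProbOn A x) ∧ (x ∉ L → F.acceptProbOn A x ≤ 1 / 3)}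

/-- `BQPRelClass C = BQP^C := ⋃ A ∈ C, BQP^A`: bounded-error quantum polynomial time relative to
some language of the class `C` (parallels G01's `PRelClass`). [Bernstein–Vazirani 1997, §8;
Aaronson 2010, §1] [cite: BernsteinVazirani1997, §8] -/
def BQPRelClass (C : Set (Language Bool)) : Set (Language Bool) :=
  ⋃ A ∈ C, BQPRel A

/-! ### Promise problems -/

/-- **PromiseBQP**: promise problems `Π = (Π.yes, Π.no)` for which some poly-time uniform,
oracle-free family of Clifford+T circuits accepts every yes-instance with probability `≥ 2/3`
and every no-instance with probability `≤ 1/3` (no condition outside the promise). Replaces the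
provisional `Literature.PQC.PromiseBQP` (outline R12). [Watrous 2009, §III.2; Goldreich 2006, §1.1] [cite: Watrous2009, §III.2] -/
def PromiseBQP : Set PromiseProblem :=
  {Q | ∃ F : QCircuitFamily cliffordT, F.IsOracleFree ∧ F.IsUniform ∧
    (∀ x ∈ Q.yes, 2 / 3 ≤ F.acceptProbOn 0 x) ∧ (∀ x ∈ Q.no, F.acceptProbOn 0 x ≤ 1 / 3)}

/-! ### Search and function problems -/

/-- `IsQSolvableRel A R`: the search problem `R` (on input `x`, output some `y ∈ R x`) is
solvable in bounded-error quantum polynomial time relative to the oracle language `A`: some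
poly-time uniform family of Clifford+T circuits with oracle gates (XOR queries to `A`), run on
`|x⟩|0…0⟩` and measured on all wires, outputs a string in `R x` with probability `≥ 2/3`. Any
classical post-processing (truncation, decoding) is folded into `R`. [Aaronson 2010, §1
(FBQP, relational problems); Watrous 2009, §III.1] [cite: Aaronson2010, §1 (FBQP  relational problems] -/
def IsQSolvableRel (A : Language Bool) (R : List Bool → Set (List Bool)) : Prop :=
  ∃ F : QCircuitFamily cliffordT, F.IsUniform ∧ ∀ x, 2 / 3 ≤ F.kernelProb A x (R x)

/-- `IsQSolvable R`: the search problem `R` is solvable in bounded-error quantum polynomial time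
(unrelativised: oracle-free families, empty oracle): some poly-time uniform, oracle-free family
of Clifford+T circuits, run on `|x⟩|0…0⟩` and measured on all wires, outputs a string in `R x`
with probability `≥ 2/3`. Post-processing is folded into `R`. [Aaronson 2010, §1 (FBQP);
Watrous 2009, §III.1] [cite: Aaronson2010, §1 (FBQP] -/
def IsQSolvable (R : List Bool → Set (List Bool)) : Prop :=
  ∃ F : QCircuitFamily cliffordT, F.IsOracleFree ∧ F.IsUniform ∧
    ∀ x, 2 / 3 ≤ F.kernelProb 0 x (R x)

/-- **FBQP**: string functions `f : {0,1}* → {0,1}*` computable in bounded-error quantum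
polynomial time: some poly-time uniform, oracle-free Clifford+T family, measured on all wires,
yields with probability `≥ 2/3` a string of which `f x` is a *prefix* (convention: the circuit
writes its answer on the first `|f x|` wires; the remaining wires are workspace).
[Aaronson 2010, §1 (FBQP); Watrous 2009, §III.1] [cite: Aaronson2010, §1 (FBQP] -/
def FBQP : Set (List Bool → List Bool) :=
  {f | IsQSolvable fun x => {y | f x <+: y}}

/-! ### API -/

section API

variable {G : QGateSet} [Encodable G.Op]

/-- Unfolding lemma for `BQPWith`. [Bernstein–Vazirani 1997, Def. 8] [cite: BernsteinVazirani1997, Def. 8] -/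
theorem mem_BQPWith_iff {ε : ℝ} {L : Language Bool} :
    L ∈ BQPWith G ε ↔ ∃ F : QCircuitFamily G, F.IsOracleFree ∧ F.IsUniform ∧
      ∀ x, (x ∈ L → 1 - ε ≤ F.acceptProbOn 0 x) ∧ (x ∉ L → F.acceptProbOn 0 x ≤ ε) :=
  Iff.rfl

/-- Unfolding lemma for `BQP` (error thresholds `2/3` and `1/3`).
[Bernstein–Vazirani 1997, Def. 8] [cite: BernsteinVazirani1997, Def. 8] -/
theorem ClassBQP.mem_BQP_iff {L : Language Bool} :
    L ∈ BQP ↔ ∃ F : QCircuitFamily cliffordT, F.IsOracleFree ∧ F.IsUniform ∧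
      ∀ x, (x ∈ L → 2 / 3 ≤ F.acceptProbOn 0 x) ∧ (x ∉ L → F.acceptProbOn 0 x ≤ 1 / 3) := by
  simp only [BQP, BQPOver, mem_BQPWith_iff]
  norm_num

/-- `BQPWith` is monotone in the error bound. [Bernstein–Vazirani 1997, Def. 8] [cite: BernsteinVazirani1997, Def. 8] -/
theorem BQPWith_mono {ε ε' : ℝ} (h : ε ≤ ε') : BQPWith G ε ⊆ BQPWith G ε' := by
  rintro L ⟨F, hF, hU, hL⟩
  refine ⟨F, hF, hU, fun x => ⟨fun hx => ?_, fun hx => ?_⟩⟩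
  · exact le_trans (by linarith) ((hL x).1 hx)
  · exact le_trans ((hL x).2 hx) h

/-- `EQP ⊆ BQP`. [Bernstein–Vazirani 1997, Def. 8] [cite: BernsteinVazirani1997, Def. 8] -/
theorem EQP_subset_BQP : EQP ⊆ BQP :=
  BQPWith_mono (by norm_num)

/-- **Error reduction for BQP**: for every constant `0 < ε < 1/2`, `BQPWith cliffordT ε = BQP`
(majority vote over parallel repetitions, Chernoff bound). [Bernstein–Vazirani 1997, §8;
Watrous 2009, §III.1 (error reduction)] [cite: BernsteinVazirani1997, §8] -/
def BQP_eq_BQPWith : Prop :=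
  ∀ {ε : ℝ} (hε : 0 < ε) (hε' : ε < 1 / 2),
    BQPWith cliffordT ε = BQP

/-- `BQP` relative to the empty oracle is `BQP`: with `A = 0` every oracle gate acts as the
identity and can be deleted (uniformly). [Bernstein–Vazirani 1997, §8] [cite: BernsteinVazirani1997, §8] -/
def BQPRel_zero : Prop :=
  BQPRel 0 = BQP

/-- `BQP ⊆ BQP^A` for every oracle `A` (oracle-free families are families, and their semantics
does not depend on the oracle, `QCircuit.toMatrix_eq_of_isOracleFree`).
[Bernstein–Vazirani 1997, §8] [cite: BernsteinVazirani1997, §8] -/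
theorem BQP_subset_BQPRel (A : Language Bool) : BQP ⊆ BQPRel A := by
  rintro L hL
  obtain ⟨F, hF, hU, h⟩ := ClassBQP.mem_BQP_iff.1 hL
  have key : ∀ x, F.acceptProbOn A x = F.acceptProbOn 0 x := fun x => by
    simp only [QCircuitFamily.acceptProbOn, QCircuit.acceptProb, QCircuit.runOn,
      QCircuit.toMatrix_eq_of_isOracleFree (hF x.length) A 0]
  exact ⟨F, hU, fun x => by rw [key]; exact h x⟩

/-- `P ⊆ BQP`: deterministic polynomial-time computation is simulated by reversible (Toffoli)
circuits, compiled exactly into Clifford+T. [Bernstein–Vazirani 1997, §8 (P ⊆ BQP);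
Nielsen–Chuang §4.5.5, §3.2.5] [cite: BernsteinVazirani1997, §8 (P ⊆ BQP] -/
def P_subset_BQP : Prop :=
  P ⊆ BQP

/-- `BQP` is closed under complement: `co BQP = BQP` (negate the output wire with
`X = H S S H`). [Bernstein–Vazirani 1997, §8; Watrous 2009, §III.1] [cite: BernsteinVazirani1997, §8] -/
def co_BQP : Prop :=
  co BQP = BQP

/-- `L ∈ BQP` iff `Lᶜ ∈ BQP` (pointwise form of `co_BQP`). [Bernstein–Vazirani 1997, §8] [cite: BernsteinVazirani1997, §8] -/
def compl_mem_BQP_iff : Prop :=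
  ∀ {L : Language Bool},
    Lᶜ ∈ BQP ↔ L ∈ BQP

/- interim proof relied on results that are now named facts (D-0014); demoted to a fact by the M5 import, proof preserved:
:= by
  change L ∈ co BQP ↔ L ∈ BQP
  rw [co_BQP]
-/

/-- A language is in `BQP` iff its promise problem (trivial promise) is in `PromiseBQP`.
[Watrous 2009, §III.2; Goldreich 2006, §1.1] [cite: Watrous2009, §III.2] -/
theorem ofLanguage_mem_PromiseBQP_iff {L : Language Bool} :
    PromiseProblem.ofLanguage L ∈ PromiseBQP ↔ L ∈ BQP := by
  rw [ClassBQP.mem_BQP_iff]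
  simp only [PromiseBQP, Set.mem_setOf_eq, PromiseProblem.yes_ofLanguage,
    PromiseProblem.no_ofLanguage]
  refine exists_congr fun F => and_congr_right fun _ => and_congr_right fun _ => ?_
  exact ⟨fun h x => ⟨h.1 x, fun hx => h.2 x hx⟩,
    fun h => ⟨fun x => (h x).1, fun x hx => (h x).2 hx⟩⟩

/-- `PromiseBQP` is closed under swapping yes- and no-instances (complement).
[Watrous 2009, §III.2] [cite: Watrous2009, §III.2] -/
def swap_mem_PromiseBQP : Prop :=
  ∀ {Q : PromiseProblem} (hQ : Q ∈ PromiseBQP),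
    Q.swap ∈ PromiseBQP

/-- Unrelativised solvability is solvability relative to the empty oracle by an oracle-free
family. [Bernstein–Vazirani 1997, §8] [cite: BernsteinVazirani1997, §8] -/
theorem IsQSolvable.isQSolvableRel_zero {R : List Bool → Set (List Bool)} (h : IsQSolvable R) :
    IsQSolvableRel 0 R := by
  obtain ⟨F, -, hU, hR⟩ := h
  exact ⟨F, hU, hR⟩

/-- Search solvability is monotone in the relation. [Aaronson 2010, §1] [cite: Aaronson2010, §1] -/
theorem IsQSolvableRel.mono {A : Language Bool} {R S : List Bool → Set (List Bool)}
    (h : IsQSolvableRel A R) (hRS : ∀ x, R x ⊆ S x) : IsQSolvableRel A S := by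
  obtain ⟨F, hU, hR⟩ := h
  refine ⟨F, hU, fun x => le_trans (hR x) ?_⟩
  refine ENNReal.toReal_mono (ne_top_of_le_ne_top ENNReal.one_ne_top ?_)
    ((F.kernel A x).toOuterMeasure_mono ((Set.inter_subset_left).trans (hRS x)))
  rw [← ((F.kernel A x).toOuterMeasure_apply_eq_one_iff Set.univ).2 (Set.subset_univ _)]
  exact (F.kernel A x).toOuterMeasure_mono (Set.inter_subset_left.trans (Set.subset_univ _))

end API

end Literature.Computability.Cryptography
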